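import Summits.Ventures.PercRepro.ProfileGapMonoThresholdAvgOneFull

/-!
# PercRepro — THE CLOSURE-REDUCED FORM OF THE THRESHOLD FAMILY: the pair identity, the EXCESS FORM of `(I_t)`,
and the regimes where the excess vanishes (p5, gen 29; `proofs/P5-GM1.md` §33; announced INBOX 13468)

For a finite matroid `N`, `q ≥ 1` and any threshold `t ≥ 0`, with `L_t = {B : ρ(B) = q−1, ρ(E∖B) ≥ t+1}`
(the demanding sets of `thresholdSum N q t`), `T_t = levelSetCoQ N t q`, `κ(S) = #coloops(S)` and
`d_t(S) = #{y ∈ coloops(S) : S ∖ y ∈ L_t}`: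
* THE PAIR IDENTITY `Σ_{B∈L_t} #(E ∖ cl B) = Σ_{S∈T_t} d_t(S)` (`sum_card_sdiff_clF_eq`): the map
  `(B, y) ↦ (B ∪ y, y)` on the pairs `B ∈ L_t`, `y ∉ cl B` lands in `T_t` (`insert_mem_levelSetCoQ_of_sdiff_clF`)
  and its fibre over `S` is exactly the set of coloops `y` of `S` with `S ∖ y ∈ L_t`;
* hence the CLOSURE-REDUCED threshold inequality on every finite matroid at EVERY offset, negative ones included:
  `Σ_{L_t} ρ(E ∖ cl B) ≤ Σ_{L_t} #(E ∖ cl B) ≤ Σ_{T_t} κ(S) ≤ q · #T_t` (`sum_rk_sdiff_clF_le`);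
* THE EXCESS FORM, a kernel iff (`thresholdIneq_iff_excess`):
  `(I_t) ⟺ Σ_{L_t} ρ(E∖B) ≤ Σ_{L_t} #(E ∖ cl B) + Σ_{T_t} (q − d_t(S))`,
  and the crude unconditional bound `thresholdSum N q t ≤ q · #T_t + (q−1) · #L_t` (`thresholdSum_le_mul_add`);
* THE REGIMES WHERE THE EXCESS VANISHES: `ρ(E∖B) ≤ #(E ∖ cl B)` on every rank-`(q−1)` set
  (`thresholdIneq_of_rk_sdiff_le_card`), in particular `ρ(E∖B) = ρ(E ∖ cl B)` (`thresholdIneq_of_rk_sdiff_clF_eq`),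
  closed rank-`(q−1)` sets (`thresholdIneq_of_clF_eq`) and GIRTH `≥ q+1` — every set of at most `q` elements
  independent (`thresholdIneq_of_girth`), with `(★_q)` at `u = q+1` and the row `(q−1, q)` there by the tree's
  bridges (`starQ_succ_of_girth`, `profileIneqMinusQ_pred_of_girth`).
Nothing open is asserted; the excess form is `(I_t)` rewritten with both sides natural numbers.
-/

open scoped Matroid

namespace PercRepro.Cogirth

open Finset ThmH Skew Shadow Profile

variable {α : Type} [DecidableEq α] {N : Matroid α} [N.Finite]

section PairIdentity

variable {q t : ℕ}

/-- `thresholdSum N q t` as the sum of `ρ(E∖B)` over the demanding sets `L_t`. -/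
theorem thresholdSum_eq_sum_filter (N : Matroid α) [N.Finite] (q t : ℕ) :
    thresholdSum N q t =
      ∑ B ∈ (Rq N (q - 1)).filter (fun B => t + 1 ≤ rk N (gr N \ B)), rk N (gr N \ B) := by
  unfold thresholdSum
  rw [sum_filter]

/-- **The up-set of a demanding set lies in `T_t`** (`1 ≤ q`): for `B ∈ L_t` and `y ∉ cl B`, `ρ(B ∪ y) = q` and
`ρ(E ∖ (B ∪ y)) ≥ ρ(E∖B) − 1 ≥ t`. -/
theorem insert_mem_levelSetCoQ_of_sdiff_clF (hq : 1 ≤ q) {B : Finset α} (hB : B ∈ Rq N (q - 1))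
    (ht : t + 1 ≤ rk N (gr N \ B)) {y : α} (hy : y ∈ gr N \ clF N B) :
    insert y B ∈ levelSetCoQ N t q := by
  obtain ⟨hBg, hBr⟩ := mem_Rq.1 hB
  have hBrk : rk N B = q - 1 := rk_eq_of_eRk_eq_cq hBr
  obtain ⟨hyg, hycl⟩ := mem_sdiff.1 hy
  have hyB : y ∉ B := notMem_of_mem_sdiff_clF hBg hy
  rw [mem_levelSetCoQ]
  refine ⟨⟨insert_subset hyg hBg, ?_⟩, ?_⟩
  · apply eRk_eq_of_rk_eq_cq
    rw [rk_insert_eq hyg hBg, if_neg hycl, hBrk]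
    omega
  · have h1 : gr N \ insert y B = (gr N \ B).erase y := by
      ext x
      simp only [mem_sdiff, mem_insert, mem_erase, not_or]
      tauto
    have h2 : y ∈ gr N \ B := mem_sdiff.2 ⟨hyg, hyB⟩
    have h3 := rk_le_rk_erase_add_one (sdiff_subset : gr N \ B ⊆ gr N) h2
    rw [h1]
    omega

/-- **The pair identity**: `Σ_{B∈L_t} #(E ∖ cl B) = Σ_{S∈T_t} #{y ∈ coloops(S) : S ∖ y ∈ L_t}` (`1 ≤ q`). The pairs
`(B, y)` with `B ∈ L_t`, `y ∉ cl B` are counted through `(B, y) ↦ (B ∪ y, y)`: the fibre over `S ∈ T_t` is the set of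
coloops `y` of `S` whose deletion `S ∖ y` is demanding. -/
theorem sum_card_sdiff_clF_eq (N : Matroid α) [N.Finite] (q t : ℕ) (hq : 1 ≤ q) :
    ∑ B ∈ (Rq N (q - 1)).filter (fun B => t + 1 ≤ rk N (gr N \ B)), (gr N \ clF N B).card =
      ∑ S ∈ levelSetCoQ N t q,
        ((coloops N S).filter
          (fun y => S.erase y ∈ (Rq N (q - 1)).filter (fun B => t + 1 ≤ rk N (gr N \ B)))).card := by
  set L := (Rq N (q - 1)).filter (fun B => t + 1 ≤ rk N (gr N \ B)) with hL
  have hmemL : ∀ B ∈ L, B ∈ Rq N (q - 1) ∧ t + 1 ≤ rk N (gr N \ B) := by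
    intro B hB
    rw [hL, mem_filter] at hB
    exact hB
  -- the left side is the number of pairs
  have h1 : ∑ B ∈ L, (gr N \ clF N B).card = ∑ p ∈ L.sigma (fun B => gr N \ clF N B), 1 := by
    rw [sum_sigma]
    simp only [sum_const, smul_eq_mul, mul_one]
  rw [h1]
  have hmaps : ∀ p ∈ L.sigma (fun B => gr N \ clF N B), insert p.2 p.1 ∈ levelSetCoQ N t q := by
    rintro ⟨B, y⟩ hp
    rw [mem_sigma] at hp
    obtain ⟨hB, ht⟩ := hmemL B hp.1
    exact insert_mem_levelSetCoQ_of_sdiff_clF hq hB ht hp.2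
  rw [← sum_fiberwise_of_maps_to hmaps]
  apply sum_congr rfl
  intro S hS
  rw [sum_const, smul_eq_mul, mul_one]
  obtain ⟨⟨hSg, hSr⟩, _⟩ := mem_levelSetCoQ.1 hS
  have hSrk : rk N S = q := rk_eq_of_eRk_eq_cq hSr
  -- membership in the fibre, unpacked
  have hfib : ∀ p : (Σ _ : Finset α, α),
      p ∈ (L.sigma (fun B => gr N \ clF N B)).filter (fun p => insert p.2 p.1 = S) ↔
        p.1 ∈ L ∧ p.2 ∈ gr N \ clF N p.1 ∧ insert p.2 p.1 = S := by
    intro p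
    rw [mem_filter, mem_sigma]
    tauto
  apply card_bij (fun p _ => p.2)
  · -- the pairs map into the demanding coloops of `S`
    rintro ⟨B, y⟩ hp
    obtain ⟨hBL, hy, hS⟩ := (hfib ⟨B, y⟩).1 hp
    obtain ⟨hB, _⟩ := hmemL B hBL
    obtain ⟨hBg, hBr⟩ := mem_Rq.1 hB
    have hBrk : rk N B = q - 1 := rk_eq_of_eRk_eq_cq hBr
    have hyB : y ∉ B := notMem_of_mem_sdiff_clF hBg hy
    simp only at hS
    have hSB : S.erase y = B := by rw [← hS, erase_insert hyB]
    rw [mem_filter, hSB]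
    refine ⟨?_, hBL⟩
    apply mem_coloops_of_rk_erase hSg (by rw [← hS]; exact mem_insert_self _ _)
    rw [hSB, hBrk, hSrk]
    omega
  · -- injective: `B = S ∖ y`
    rintro ⟨B₁, y₁⟩ hp₁ ⟨B₂, y₂⟩ hp₂ heq
    simp only at heq
    subst heq
    obtain ⟨hBL₁, hy₁, hS₁⟩ := (hfib ⟨B₁, y₁⟩).1 hp₁
    obtain ⟨hBL₂, hy₂, hS₂⟩ := (hfib ⟨B₂, y₁⟩).1 hp₂
    have hyB₁ : y₁ ∉ B₁ := notMem_of_mem_sdiff_clF (mem_Rq.1 (hmemL B₁ hBL₁).1).1 hy₁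
    have hyB₂ : y₁ ∉ B₂ := notMem_of_mem_sdiff_clF (mem_Rq.1 (hmemL B₂ hBL₂).1).1 hy₂
    have hB : B₁ = B₂ := by
      simp only at hS₁ hS₂
      rw [← erase_insert hyB₁, ← erase_insert hyB₂, hS₁, hS₂]
    subst hB
    rfl
  · -- surjective: a demanding coloop `y` of `S` comes from `(S ∖ y, y)`
    intro y hy
    rw [mem_filter] at hy
    obtain ⟨hyc, hyL⟩ := hy
    obtain ⟨hyS, hycl⟩ := mem_coloops.1 hyc
    refine ⟨⟨S.erase y, y⟩, ?_, rfl⟩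
    rw [hfib]
    exact ⟨hyL, mem_sdiff.2 ⟨hSg hyS, hycl⟩, insert_erase hyS⟩

/-- `d_t(S) ≤ κ(S)`: the demanding coloops of `S` are coloops of `S`. -/
theorem sum_card_sdiff_clF_le_sum_card_coloops (N : Matroid α) [N.Finite] (q t : ℕ) (hq : 1 ≤ q) :
    ∑ B ∈ (Rq N (q - 1)).filter (fun B => t + 1 ≤ rk N (gr N \ B)), (gr N \ clF N B).card ≤
      ∑ S ∈ levelSetCoQ N t q, (coloops N S).card := by
  rw [sum_card_sdiff_clF_eq N q t hq]
  exact sum_le_sum (fun S _ => card_le_card (filter_subset _ _))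

/-- `κ(S) ≤ ρ(S) = q` on `T_t`: `Σ_{T_t} κ(S) ≤ q · #T_t`. -/
theorem sum_card_coloops_levelSetCoQ_le (N : Matroid α) [N.Finite] (q t : ℕ) :
    ∑ S ∈ levelSetCoQ N t q, (coloops N S).card ≤ q * (levelSetCoQ N t q).card := by
  calc ∑ S ∈ levelSetCoQ N t q, (coloops N S).card ≤ ∑ _S ∈ levelSetCoQ N t q, q := by
        apply sum_le_sum
        intro S hS
        obtain ⟨⟨hSg, hSr⟩, _⟩ := mem_levelSetCoQ.1 hS
        have h := card_coloops_le_rk hSg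
        rw [rk_eq_of_eRk_eq_cq hSr] at h
        exact h
    _ = q * (levelSetCoQ N t q).card := by rw [sum_const, smul_eq_mul, mul_comm]

/-- **The closure-reduced threshold inequality** (every finite matroid, every `q ≥ 1`, EVERY `t ≥ 0`):
`Σ_{B∈L_t} ρ(E ∖ cl B) ≤ q · #T_t`. -/
theorem sum_rk_sdiff_clF_le (N : Matroid α) [N.Finite] (q t : ℕ) (hq : 1 ≤ q) :
    ∑ B ∈ (Rq N (q - 1)).filter (fun B => t + 1 ≤ rk N (gr N \ B)), rk N (gr N \ clF N B) ≤
      q * (levelSetCoQ N t q).card :=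
  (sum_le_sum (fun B _ => rk_le_card (gr N \ clF N B))).trans
    ((sum_card_sdiff_clF_le_sum_card_coloops N q t hq).trans (sum_card_coloops_levelSetCoQ_le N q t))

end PairIdentity

section ExcessForm

variable {q t : ℕ}

/-- `d_t(S) ≤ q` on `T_t`. -/
theorem card_filter_coloops_le {S : Finset α} (hS : S ∈ levelSetCoQ N t q) :
    ((coloops N S).filter
      (fun y => S.erase y ∈ (Rq N (q - 1)).filter (fun B => t + 1 ≤ rk N (gr N \ B)))).card ≤ q := by
  obtain ⟨⟨hSg, hSr⟩, _⟩ := mem_levelSetCoQ.1 hS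
  have h := card_coloops_le_rk hSg
  rw [rk_eq_of_eRk_eq_cq hSr] at h
  exact (card_le_card (filter_subset _ _)).trans h

/-- **The excess form of `(I_t)`** (`1 ≤ q`): `ThresholdIneq N q t` holds iff
`Σ_{B∈L_t} ρ(E∖B) ≤ Σ_{B∈L_t} #(E ∖ cl B) + Σ_{S∈T_t} (q − d_t(S))` — the demand of the demanding sets in excess of
their own up-pairs must be paid by the slack of the rank-`q` sets. -/
theorem thresholdIneq_iff_excess (hq : 1 ≤ q) :
    ThresholdIneq N q t ↔
      ∑ B ∈ (Rq N (q - 1)).filter (fun B => t + 1 ≤ rk N (gr N \ B)), rk N (gr N \ B) ≤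
        ∑ B ∈ (Rq N (q - 1)).filter (fun B => t + 1 ≤ rk N (gr N \ B)), (gr N \ clF N B).card +
          ∑ S ∈ levelSetCoQ N t q,
            (q - ((coloops N S).filter
              (fun y => S.erase y ∈ (Rq N (q - 1)).filter (fun B => t + 1 ≤ rk N (gr N \ B)))).card) := by
  unfold ThresholdIneq
  rw [thresholdSum_eq_sum_filter]
  have hsplit : q * (levelSetCoQ N t q).card =
      ∑ S ∈ levelSetCoQ N t q,
        ((coloops N S).filter
          (fun y => S.erase y ∈ (Rq N (q - 1)).filter (fun B => t + 1 ≤ rk N (gr N \ B)))).card +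
      ∑ S ∈ levelSetCoQ N t q,
        (q - ((coloops N S).filter
          (fun y => S.erase y ∈ (Rq N (q - 1)).filter (fun B => t + 1 ≤ rk N (gr N \ B)))).card) := by
    rw [← sum_add_distrib]
    rw [sum_congr rfl (fun S hS => Nat.add_sub_cancel' (card_filter_coloops_le hS))]
    rw [sum_const, smul_eq_mul, mul_comm]
  rw [hsplit, ← sum_card_sdiff_clF_eq N q t hq]

/-- **The crude unconditional bound**: `ρ(E∖B) ≤ #(E ∖ cl B) + (q − 1)` for every rank-`(q−1)` set `B`
(`E∖B = (E ∖ cl B) ⊔ (cl B ∖ B)` and `ρ(cl B ∖ B) ≤ ρ(cl B) = q − 1`). -/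
theorem rk_sdiff_le_card_sdiff_clF_add {B : Finset α} (hB : B ∈ Rq N (q - 1)) :
    rk N (gr N \ B) ≤ (gr N \ clF N B).card + (q - 1) := by
  obtain ⟨hBg, hBr⟩ := mem_Rq.1 hB
  have hBrk : rk N B = q - 1 := rk_eq_of_eRk_eq_cq hBr
  have hsplit : gr N \ B = (gr N \ clF N B) ∪ (clF N B \ B) := by
    ext x
    simp only [mem_sdiff, mem_union]
    constructor
    · rintro ⟨hx, hxB⟩
      by_cases h : x ∈ clF N B
      · exact Or.inr ⟨h, hxB⟩
      · exact Or.inl ⟨hx, h⟩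
    · rintro (⟨hx, hxc⟩ | ⟨hx, hxB⟩)
      · exact ⟨hx, fun h => hxc (subset_clF hBg h)⟩
      · exact ⟨clF_subset_gr B hx, hxB⟩
  calc rk N (gr N \ B) = rk N ((gr N \ clF N B) ∪ (clF N B \ B)) := by rw [hsplit]
    _ ≤ rk N (gr N \ clF N B) + rk N (clF N B \ B) := rk_union_le _ _
    _ ≤ (gr N \ clF N B).card + rk N (clF N B) :=
        add_le_add (rk_le_card _) (rk_mono' sdiff_subset)
    _ = (gr N \ clF N B).card + (q - 1) := by rw [rk_clF, hBrk]

/-- **`(I_t)` up to `(q − 1) · #L_t`, unconditionally**: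
`thresholdSum N q t ≤ q · #T_t + (q − 1) · #L_t` (`1 ≤ q`). -/
theorem thresholdSum_le_mul_add (N : Matroid α) [N.Finite] (q t : ℕ) (hq : 1 ≤ q) :
    thresholdSum N q t ≤
      q * (levelSetCoQ N t q).card +
        (q - 1) * ((Rq N (q - 1)).filter (fun B => t + 1 ≤ rk N (gr N \ B))).card := by
  rw [thresholdSum_eq_sum_filter]
  calc ∑ B ∈ (Rq N (q - 1)).filter (fun B => t + 1 ≤ rk N (gr N \ B)), rk N (gr N \ B)
      ≤ ∑ B ∈ (Rq N (q - 1)).filter (fun B => t + 1 ≤ rk N (gr N \ B)), ((gr N \ clF N B).card + (q - 1)) :=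
        sum_le_sum (fun B hB => rk_sdiff_le_card_sdiff_clF_add (mem_filter.1 hB).1)
    _ = ∑ B ∈ (Rq N (q - 1)).filter (fun B => t + 1 ≤ rk N (gr N \ B)), (gr N \ clF N B).card +
          (q - 1) * ((Rq N (q - 1)).filter (fun B => t + 1 ≤ rk N (gr N \ B))).card := by
        rw [sum_add_distrib, sum_const, smul_eq_mul, mul_comm]
    _ ≤ q * (levelSetCoQ N t q).card +
          (q - 1) * ((Rq N (q - 1)).filter (fun B => t + 1 ≤ rk N (gr N \ B))).card :=
        Nat.add_le_add_right
          ((sum_card_sdiff_clF_le_sum_card_coloops N q t hq).trans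
            (sum_card_coloops_levelSetCoQ_le N q t)) _

end ExcessForm

section Regimes

variable {q t : ℕ}

/-- **No excess, no problem**: if every rank-`(q−1)` set has `ρ(E∖B) ≤ #(E ∖ cl B)`, `(I_t)` holds (`1 ≤ q`,
every `t`). -/
theorem thresholdIneq_of_rk_sdiff_le_card (hq : 1 ≤ q)
    (h : ∀ B ∈ Rq N (q - 1), rk N (gr N \ B) ≤ (gr N \ clF N B).card) : ThresholdIneq N q t := by
  rw [thresholdIneq_iff_excess hq]
  exact le_add_right (sum_le_sum (fun B hB => h B (mem_filter.1 hB).1))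

/-- **The regime `(CL_q)`**: if the rank of `E∖B` is carried outside the closure, `ρ(E∖B) = ρ(E ∖ cl B)`, for every
rank-`(q−1)` set `B`, then `(I_t)` holds at every offset (`1 ≤ q`). -/
theorem thresholdIneq_of_rk_sdiff_clF_eq (hq : 1 ≤ q)
    (h : ∀ B ∈ Rq N (q - 1), rk N (gr N \ B) = rk N (gr N \ clF N B)) : ThresholdIneq N q t :=
  thresholdIneq_of_rk_sdiff_le_card hq (fun B hB => (h B hB).le.trans (rk_le_card _))

/-- **Closed rank-`(q−1)` sets**: if every rank-`(q−1)` set is closed, `(I_t)` holds at every offset (`1 ≤ q`). -/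
theorem thresholdIneq_of_clF_eq (hq : 1 ≤ q) (h : ∀ B ∈ Rq N (q - 1), clF N B = B) :
    ThresholdIneq N q t :=
  thresholdIneq_of_rk_sdiff_clF_eq hq (fun B hB => by rw [h B hB])

/-- **Girth `≥ q + 1` closes the rank-`(q−1)` sets**: if every set of at most `q` elements is independent, a
rank-`(q−1)` set is an independent `(q−1)`-set and its closure adds no point (`1 ≤ q`). -/
theorem clF_eq_self_of_girth (hq : 1 ≤ q) (hg : ∀ T ⊆ gr N, T.card ≤ q → N.Indep (T : Set α))
    {B : Finset α} (hB : B ∈ Rq N (q - 1)) : clF N B = B := by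
  obtain ⟨hBg, hBr⟩ := mem_Rq.1 hB
  have hBrk : rk N B = q - 1 := rk_eq_of_eRk_eq_cq hBr
  -- `#B ≤ q − 1`: a `q`-subset would be independent of rank `q > ρ(B)`
  have hcard : B.card ≤ q - 1 := by
    by_contra hlt
    obtain ⟨T, hTB, hTc⟩ := exists_subset_card_eq (show q ≤ B.card by omega)
    have hT : rk N T = T.card := rk_eq_card_of_indep (hg T (hTB.trans hBg) hTc.le)
    have hTB' := rk_mono' (M := N) hTB
    omega
  apply Subset.antisymm _ (subset_clF hBg)
  intro y hy
  by_contra hyB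
  have hyg : y ∈ gr N := clF_subset_gr B hy
  have hT : N.Indep ((insert y B : Finset α) : Set α) :=
    hg _ (insert_subset hyg hBg) (by rw [card_insert_of_notMem hyB]; omega)
  have h1 := rk_eq_card_of_indep hT
  rw [card_insert_of_notMem hyB, (mem_clF_iff_rk_insert hyg hBg).1 hy] at h1
  have h2 := rk_le_card (M := N) B
  omega

/-- **The girth regime of the threshold family**: if every set of at most `q` elements is independent (no circuit
of size `≤ q`), `(I_t)` holds at every offset `t ≥ 0` (`1 ≤ q`). -/
theorem thresholdIneq_of_girth (hq : 1 ≤ q) (hg : ∀ T ⊆ gr N, T.card ≤ q → N.Indep (T : Set α)) :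
    ThresholdIneq N q t :=
  thresholdIneq_of_clF_eq hq (fun _ hB => clF_eq_self_of_girth hq hg hB)

/-- **`(★_q)` at the level `u = q + 1` on a girth-`≥ q+1` deletion**: if every set of at most `q` elements of
`M ∖ z` is independent, `StarQ M z q (q + 1)` (`1 ≤ q`). -/
theorem starQ_succ_of_girth {M : Matroid α} [M.Finite] {z : α} (hq : 1 ≤ q)
    (hg : ∀ T ⊆ gr (M ＼ ({z} : Set α)), T.card ≤ q → (M ＼ ({z} : Set α)).Indep (T : Set α)) :
    StarQ M z q (q + 1) :=
  (starQ_succ_iff_thresholdIneq hq).2 (thresholdIneq_of_girth hq hg)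

/-- **The row `(q − 1, q)` on girth `≥ q + 1`**: `ProfileIneqMinusQ N (q − 1) q` when every set of at most `q`
elements is independent (`1 ≤ q`). -/
theorem profileIneqMinusQ_pred_of_girth (hq : 1 ≤ q)
    (hg : ∀ T ⊆ gr N, T.card ≤ q → N.Indep (T : Set α)) : ProfileIneqMinusQ N (q - 1) q :=
  (thresholdIneq_iff_row hq).1 (thresholdIneq_of_girth hq hg)

end Regimes

end PercRepro.Cogirth
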